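import Literature.AlgebraicGeometry.Resolution.RestrictionPropertyCartier
import Literature.AlgebraicGeometry.Resolution.BlowupStalkCharts
import Literature.AlgebraicGeometry.Resolution.RegularCentreRsopPartNested
import HarnessLib

/-!
# The restriction property for a regular pair, local half: the exceptional divisor is a nonzerodivisor modulo the
# transform of a regular subscheme through a regular centre (BGMW 2011 §4 Remark (3), any codimension)

Topic: `Literature/AlgebraicGeometry/Resolution`. Bierstone–Grigoriev–Milman–Włodarczyk, arXiv:1206.3090, §4
Remark (3): "If `X` is a smooth variety containing a smooth subvariety `Y ⊂ X`, which contains the center `C ⊂ Y`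
then the blow-up `σ_{C,Y} : Ỹ → Y` at `C` coincides with the strict transform of `Y` under the blow-up
`σ_{C,X} : X̃ → X`." `HypersurfaceRestriction.lean` / `HypersurfaceTransform.lean` prove this for a regular
HYPERSURFACE `Y`; `RestrictionPropertyCartier.lean` isolates the formal half for any codimension (the restriction
property, and `ker Bl_C(k) = (π^*(ker k) : 𝓘(D))`, GIVEN that `𝓘(D)` restricts to an effective Cartier divisor on
`V((π^*H : 𝓘(D)))`). This file PROVES that remaining local statement for a regular `Y = V(H)` of ANY codimension:

* `IsBlowup.mem_stalkIdeal_controlledTransform_of_mul_mem` — STALK FORM: `X` locally Noetherian and regular,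
  `π : X' → X` a blow-up along `C` with `V(C)` regular, `H ≤ C` with `V(H)` regular, `x'` a point over the centre,
  `𝓘(D)_{x'} = (t)`; then `s t ∈ H'_{x'} ⇒ s ∈ H'_{x'}` for `H' = (π^*H : 𝓘(D))`. Proof (no saturation computation):
  at `x = π x'` there is a regular system of parameters `(c, w)` of `𝒪_{X,x}` with `C_x = (c)`, `H_x = (c_1, …, c_a)`
  (nested Matsumura 14.2, `exists_isRsopPart_nested_span_range_eq_stalkIdeal`, `RegularCentreRsopPartNested.lean`);
  `𝒪_{X',x'}` is the localisation of the Rees chart `(R[It])_{(c_j t)}` at a prime `𝔴` over `𝔪_x`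
  (`IsBlowup.exists_reesChart_stalk`, `BlowupStalkCharts.lean`); there `𝓘(D)_{x'} = (t₀)`, `t₀ = c_j/1` a
  nonzerodivisor, `π^*H·𝒪_{x'} = t₀·(e_m)_{m ≤ a}` with `e_m = c_m/c_j` the chart generators, so
  `H'_{x'} = ((t₀)(e) : (t₀)) = (e_m)_{m ≤ a}`; if some `e_m` is a unit this is `(1)`; otherwise the `e_m` lie in `𝔴`,
  `(t₀, (e_m)_m, w)` is part of a regular system of parameters of `𝒪_{X',x'}` (`isRsopPart_chartFamily_reesChart`,
  `BlowupChartRsop.lean`), so `(e_m)_m` is prime and does not contain `t₀` (`IsRsopPart.isPrime_span_range`,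
  `IsRsopPart.not_mem_span_image`).
* `mem_ideal_of_mul_mem_of_isRegular_subscheme` — AFFINE FORM (the shape of `mem_ideal_of_mul_mem_of_hypersurface`
  with the hypersurface hypothesis replaced by `Scheme.IsRegular H.subscheme`): on an affine open `V ⊆ X'` with
  `𝓘(D)(V) = (g₀)`, `s g₀ ∈ H'(V) ⇒ s ∈ H'(V)` (localise at maximal ideals; off the centre `g₀` is a unit).
* **`IsBlowup.isEffectiveCartier_comap_subschemeι_controlledTransform_of_isRegular`** — `𝓘(D)|_{V(H')}` is an
  effective Cartier divisor; with `RestrictionPropertyCartier.lean` this yields the restriction property and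
  `ker Bl_C(k) = (π^*(ker k) : 𝓘(D))` for regular `W = V(H) ⊇ V(C)` in regular `X`.

* `IsBlowup.isBlowup_subscheme_controlledTransform_of_isRegular`, `IsBlowup.ker_strictTransformHom_of_isRegular` — the
  hypothesis-free corollaries: restriction property for a regular pair in any codimension, and the ideal of the strict
  transform of a regular `W ⊇ V(C)` is the transform of `𝓘_W` with exponent one.

Consumer: the Hironaka-2017 typing (§3.2.1 rows 026/027, GAP row R81: `PStrictReg_of_restrictionCartier`,
`Proofs/S03DiffARNE/PStrictReg.lean`). Route shared on the campaign bus with res-type-026 (STATUS 2026-08-27T01:28:00Z);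
nested-parameter lemmas by res-D-pv-010.

## Sources
* [BGMW 2011] §4 Remark (3); §3.6 Lemma 3.6.4 (4), (6) (arXiv:1206.3090, pp. 8, 11). [BierstoneGrigorievMilmanWlodarczyk2011]
* H. Matsumura, *Commutative Ring Theory*, Thm. 14.2 (regular local rings and regular sequences), via
  `RegularCentreRsopPartNested.lean`, `RsopMonomialIdeals.lean`. [Matsumura1987]
* The Stacks Project, Tags 0804, 0BIQ (affine blow-up algebra and its charts), via `BlowupChartRsop.lean`,
  `BlowupStalkCharts.lean`. [StacksProject]
-/

noncomputable section

open CategoryTheory CategoryTheory.Limits AlgebraicGeometry TopologicalSpace IsLocalRing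

namespace Literature.AlgebraicGeometry.Resolution

universe u



section Local

variable {X X' : Scheme.{u}} [IsLocallyNoetherian X] {π : X' ⟶ X} {C H : X.IdealSheafData}

/-- **Stalk form of the regular-pair restriction lemma.** `X` locally Noetherian and regular, `π` a blow-up along `C`
with `V(C)` regular, `H ≤ C` with `V(H)` regular, `x'` over the centre, `(t) = 𝓘(D)_{x'}`: if `s t ∈ H'_{x'}` then
`s ∈ H'_{x'}`, `H' = (π^*H : 𝓘(D))` — i.e. the equation of the exceptional divisor is a nonzerodivisor modulo the
transform of `V(H)`; see the module docstring for the chart argument.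
[cite: BierstoneGrigorievMilmanWlodarczyk2011, §4 Remark (3) (restriction property), with Lemma 3.6.4 (4) for the hypersurface case] -/
theorem IsBlowup.mem_stalkIdeal_controlledTransform_of_mul_mem (hX : Scheme.IsRegular X) (hπ : IsBlowup π C)
    (hC : Scheme.IsRegular C.subscheme) (hHC : H ≤ C) (hH : Scheme.IsRegular H.subscheme) (x' : X')
    (hxC : π x' ∈ C.support) {s t : X'.presheaf.stalk x'} (ht : stalkIdeal (C.comap π) x' = Ideal.span {t})
    (hst : s * t ∈ stalkIdeal (controlledTransform π C H 1) x') :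
    s ∈ stalkIdeal (controlledTransform π C H 1) x' := by
  classical
  haveI : IsProper π := hπ.isProper
  haveI : IsLocallyNoetherian X' := LocallyOfFiniteType.isLocallyNoetherian π
  haveI : IsRegularLocalRing (X.presheaf.stalk (π x')) := hX _
  -- nested generators `c = (h, g)` of `C_x ⊇ H_x`, part of a regular system of parameters `(c, w)`
  obtain ⟨a, b, c, hrsop, hCc, hHc⟩ := exists_isRsopPart_nested_span_range_eq_stalkIdeal hHC hH hC hxC
  obtain ⟨e, xr, hd, hxr, hxc⟩ := hrsop.exists_rsop
  let w : Fin e → X.presheaf.stalk (π x') := fun k => xr (Fin.natAdd (a + b) k)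
  have happ : Fin.append c w = xr := by
    ext l
    induction l using Fin.addCases with
    | left m => rw [Fin.append_left, hxc]
    | right k => rw [Fin.append_right]
  have hz : Ideal.span (Set.range (Fin.append c w)) = maximalIdeal _ := by rw [happ, hxr]
  -- the Rees chart through `x'`
  obtain ⟨j, 𝔴, χ, hχ, hloc, h𝔴⟩ := hπ.exists_reesChart_stalk x' c hCc
  letI := χ.toAlgebra
  haveI := hloc
  let t₀ : X'.presheaf.stalk x' := χ (chartBase c j (c j))
  have hχc : ∀ l, (π.stalkMap x').hom (c l) = t₀ * χ (chartGen c j l) := by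
    intro l
    rw [← hχ, ← map_mul]
    exact congrArg χ (reesChartBase_apply_eq_mul_chartGen c j l)
  -- `𝓘(D)_{x'} = (t₀)`
  have hCst : stalkIdeal (C.comap π) x' = Ideal.span {t₀} := by
    rw [stalkIdeal_comap_eq_map_stalkMap, ← hCc, Ideal.map_span]
    apply le_antisymm
    · rw [Ideal.span_le]
      rintro _ ⟨_, ⟨l, rfl⟩, rfl⟩
      rw [SetLike.mem_coe, hχc l]
      exact Ideal.mul_mem_right _ _ (Ideal.mem_span_singleton_self _)
    · rw [Ideal.span_singleton_le_iff_mem]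
      have h1 : (π.stalkMap x').hom (c j) = t₀ := (hχ (c j)).symm
      rw [← h1]
      exact Ideal.subset_span ⟨c j, ⟨j, rfl⟩, rfl⟩
  have ht₀ : t₀ ∈ nonZeroDivisors (X'.presheaf.stalk x') :=
    IsLocalization.nonZeroDivisors_le_comap 𝔴.asIdeal.primeCompl (X'.presheaf.stalk x')
      (reesChartBase_mem_nonZeroDivisors (c j) (Ideal.mem_span_range_self (f := c) (x := j)))
  -- `H'_{x'} = (ε_m : m < a)`, `ε_m = e_{castAdd b m}`
  let ε : Fin a → X'.presheaf.stalk x' := fun m => χ (chartGen c j (Fin.castAdd b m))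
  have hHmap : (stalkIdeal H (π x')).map (π.stalkMap x').hom = Ideal.span {t₀} * Ideal.span (Set.range ε) := by
    rw [← hHc, Ideal.map_span, Ideal.span_mul_span', Set.singleton_mul]
    congr 1
    ext y
    constructor
    · rintro ⟨_, ⟨m, rfl⟩, rfl⟩
      exact ⟨ε m, ⟨m, rfl⟩, (hχc (Fin.castAdd b m)).symm⟩
    · rintro ⟨_, ⟨m, rfl⟩, rfl⟩
      exact ⟨c (Fin.castAdd b m), ⟨m, rfl⟩, hχc (Fin.castAdd b m)⟩
  have hH'P : stalkIdeal (controlledTransform π C H 1) x' = Ideal.span (Set.range ε) := by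
    rw [controlledTransform, pow_one, stalkIdeal_colon, stalkIdeal_comap_eq_map_stalkMap, hHmap, hCst,
      Submodule.colon_span]
    exact colon_span_singleton_mul_eq ht₀ _
  -- `t` and `t₀` generate the same ideal
  have htt₀ : t₀ ∈ Ideal.span {t} := by rw [← ht, hCst]; exact Ideal.mem_span_singleton_self _
  have ht₀t : t ∈ Ideal.span {t₀} := by rw [← hCst, ht]; exact Ideal.mem_span_singleton_self _
  rw [hH'P] at hst ⊢
  -- if some `ε_m` is a unit, `H'_{x'} = (1)`
  by_cases hunit : ∀ m, ¬ IsUnit (ε m)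
  swap
  · simp only [not_forall, not_not] at hunit
    obtain ⟨m, hm⟩ := hunit
    have : Ideal.span (Set.range ε) = ⊤ :=
      Ideal.eq_top_of_isUnit_mem _ (Ideal.subset_span ⟨m, rfl⟩) hm
    rw [this]; trivial
  -- otherwise all `e_{castAdd b m}` lie in `𝔴`, and `(t₀, ε)` is part of a regular system of parameters of `L`
  have hmem : ∀ m, chartGen c j (Fin.castAdd b m) ∈ 𝔴.asIdeal := by
    intro m
    have h := hunit m
    rw [← IsLocalization.AtPrime.to_map_mem_maximal_iff (X'.presheaf.stalk x') 𝔴.asIdeal]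
    exact (IsLocalRing.mem_maximalIdeal _).mpr h
  have hne : ∀ m, Fin.castAdd b m ≠ j := by
    intro m h
    apply hunit m
    change IsUnit (χ (chartGen c j (Fin.castAdd b m)))
    have h1 : chartGen c j j = 1 := chartGen_self c j
    rw [h, h1, map_one]
    exact isUnit_one
  let jJ : Fin a → {l : Fin (a + b) // l ≠ j} := fun m => ⟨Fin.castAdd b m, hne m⟩
  have hjJ : Function.Injective jJ := fun m m' h => by
    have := congrArg Subtype.val h
    exact Fin.castAdd_injective _ _ this
  have hζ := isRsopPart_chartFamily_reesChart c j w hz (by exact_mod_cast hd) 𝔴.asIdeal h𝔴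
    (X'.presheaf.stalk x') jJ hjJ (fun m => hmem m)
  let ι : Fin a → Fin (a + e + 1) := fun m => (Fin.castAdd e m).succ
  have hι : Function.Injective ι := fun m m' h =>
    Fin.castAdd_injective _ _ (Fin.succ_injective _ h)
  have hζι : chartFamily c j w (X'.presheaf.stalk x') (chartBase c j) (chartGen c j) jJ ∘ ι = ε := by
    funext m
    simp only [Function.comp_apply, ι, chartFamily, Fin.cons_succ, Fin.append_left]
    rfl
  have hζ0 : chartFamily c j w (X'.presheaf.stalk x') (chartBase c j) (chartGen c j) jJ 0 = t₀ := by
    simp only [chartFamily, Fin.cons_zero]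
    rfl
  have hP : (Ideal.span (Set.range ε)).IsPrime := by
    rw [← hζι]
    exact (hζ.comp ι hι).isPrime_span_range
  have ht₀P : t₀ ∉ Ideal.span (Set.range ε) := by
    have h := hζ.not_mem_span_image (S := Set.range ι) (i := 0) (by
      rintro ⟨m, hm⟩
      exact Fin.succ_ne_zero _ hm)
    rwa [hζ0, ← Set.range_comp, hζι] at h
  have htP : t ∉ Ideal.span (Set.range ε) := by
    intro h
    apply ht₀P
    obtain ⟨r, hr⟩ := Ideal.mem_span_singleton'.mp htt₀
    rw [← hr]
    exact Ideal.mul_mem_left _ r h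
  exact (hP.mem_or_mem hst).resolve_right htP

/-- **Affine form** (the shape of `mem_ideal_of_mul_mem_of_hypersurface` with the hypersurface hypothesis replaced by
`Scheme.IsRegular H.subscheme`): on an affine open `V ⊆ X'` where `𝓘(D)(V) = (g₀)`, `s g₀ ∈ H'(V) ⇒ s ∈ H'(V)` (check
at the stalks at maximal ideals; off the centre `g₀` is a unit).
[cite: BierstoneGrigorievMilmanWlodarczyk2011, §4 Remark (3) (restriction property)] -/
theorem mem_ideal_of_mul_mem_of_isRegular_subscheme (hX : Scheme.IsRegular X) (hπ : IsBlowup π C)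
    (hC : Scheme.IsRegular C.subscheme) (hHC : H ≤ C) (hH : Scheme.IsRegular H.subscheme)
    (V : X'.affineOpens) {g₀ : Γ(X', V)} (hDV : (C.comap π).ideal V = Ideal.span {g₀})
    {s : Γ(X', V)} (hs : s * g₀ ∈ (controlledTransform π C H 1).ideal V) :
    s ∈ (controlledTransform π C H 1).ideal V := by
  haveI : IsProper π := hπ.isProper
  haveI : IsLocallyNoetherian X' := LocallyOfFiniteType.isLocallyNoetherian π
  refine Ideal.mem_of_localization_maximal fun P hP => ?_
  let p : PrimeSpectrum Γ(X', V) := ⟨P, hP.isPrime⟩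
  have hy : V.2.fromSpec p ∈ (V : X'.Opens) := V.2.range_fromSpec.le ⟨p, rfl⟩
  letI alg : Algebra Γ(X', V) (X'.presheaf.stalk (V.2.fromSpec p)) :=
    (X'.presheaf.germ V _ hy).hom.toAlgebra
  haveI : IsLocalization.AtPrime (X'.presheaf.stalk (V.2.fromSpec p)) P :=
    V.2.isLocalization_stalk' p hy
  -- it suffices to check `germ s ∈ H'_y`
  suffices hst : (X'.presheaf.germ V _ hy).hom s ∈ stalkIdeal (controlledTransform π C H 1)
      (V.2.fromSpec p) by
    let ε := (IsLocalization.algEquiv P.primeCompl (X'.presheaf.stalk (V.2.fromSpec p))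
      (Localization.AtPrime P))
    have h1 : ((stalkIdeal (controlledTransform π C H 1) (V.2.fromSpec p)).map ε.toRingEquiv.toRingHom) =
        ((controlledTransform π C H 1).ideal V).map (algebraMap _ (Localization.AtPrime P)) := by
      rw [stalkIdeal_eq_map_germ _ V hy, Ideal.map_map]
      congr 1
      ext a
      exact ε.commutes a
    rw [← h1]
    have h2 : algebraMap Γ(X', V) (Localization.AtPrime P) s =
        ε.toRingEquiv.toRingHom ((X'.presheaf.germ V _ hy).hom s) := (ε.commutes s).symm
    rw [h2]
    exact Ideal.mem_map_of_mem _ hst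
  -- the stalk of `𝓘(D)` at `y` is generated by `germ g₀`, and `germ s · germ g₀ ∈ H'_y`
  have hDy : stalkIdeal (C.comap π) (V.2.fromSpec p) = Ideal.span {(X'.presheaf.germ V _ hy).hom g₀} := by
    rw [stalkIdeal_eq_map_germ _ V hy, hDV, Ideal.map_span, Set.image_singleton]
  have hprod : (X'.presheaf.germ V _ hy).hom s * (X'.presheaf.germ V _ hy).hom g₀ ∈
      stalkIdeal (controlledTransform π C H 1) (V.2.fromSpec p) := by
    rw [← map_mul, stalkIdeal_eq_map_germ _ V hy]
    exact Ideal.mem_map_of_mem _ hs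
  by_cases hyC : π (V.2.fromSpec p) ∈ C.support
  · exact hπ.mem_stalkIdeal_controlledTransform_of_mul_mem hX hC hHC hH _ hyC hDy hprod
  · -- off the centre `germ g₀` is a unit
    have hnot : V.2.fromSpec p ∉ ((C.comap π).support : Set X') := by
      rw [Scheme.IdealSheafData.support_comap]
      exact hyC
    have htop : stalkIdeal (C.comap π) (V.2.fromSpec p) = ⊤ := stalkIdeal_eq_top_of_not_mem_support hnot
    rw [hDy, Ideal.span_singleton_eq_top] at htop
    exact (Ideal.mul_unit_mem_iff_mem _ htop).mp hprod

/-- **The exceptional divisor restricts to an effective Cartier divisor on the transform `V((π^*H : 𝓘(D)))` of a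
regular `V(H) ⊇ V(C)`** (`X` regular locally Noetherian, `V(C)` regular) — the local half of the restriction property in
any codimension (the hypersurface case is `IsBlowup.isEffectiveCartier_comap_subschemeι_controlledTransform`).
[cite: BierstoneGrigorievMilmanWlodarczyk2011, §4 Remark (3) (restriction property), Lemma 3.6.4 (6)] -/
theorem IsBlowup.isEffectiveCartier_comap_subschemeι_controlledTransform_of_isRegular (hX : Scheme.IsRegular X)
    (hπ : IsBlowup π C) (hC : Scheme.IsRegular C.subscheme) (hHC : H ≤ C) (hH : Scheme.IsRegular H.subscheme) :
    IsEffectiveCartier ((C.comap π).comap (controlledTransform π C H 1).subschemeι) :=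
  hπ.isEffectiveCartier_comap_subschemeι_controlledTransform_of_affine fun V _ _ hDV hs =>
    mem_ideal_of_mul_mem_of_isRegular_subscheme hX hπ hC hHC hH V hDV hs

/-! ## Corollaries: the restriction property for regular pairs, in any codimension -/

/-- **Restriction property (BGMW §4 Remark (3)) for a regular pair, any codimension**: `X` regular locally Noetherian,
`π : X' → X` a blow-up along `C` with `V(C)` regular, `H ≤ C` with `V(H)` regular; then every morphism
`V((π^*H : 𝓘(D))) → V(H)` over `π` is a blow-up of `V(H)` along `C|_{V(H)}` («the blow-up of `Y` at `C` coincides with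
the strict transform of `Y`»). [cite: BierstoneGrigorievMilmanWlodarczyk2011, §4 Remark (3)] -/
theorem IsBlowup.isBlowup_subscheme_controlledTransform_of_isRegular (hX : Scheme.IsRegular X) (hπ : IsBlowup π C)
    (hC : Scheme.IsRegular C.subscheme) (hHC : H ≤ C) (hH : Scheme.IsRegular H.subscheme)
    (πS : (controlledTransform π C H 1).subscheme ⟶ H.subscheme)
    (hπS : πS ≫ H.subschemeι = (controlledTransform π C H 1).subschemeι ≫ π) :
    IsBlowup πS (C.comap H.subschemeι) :=
  hπ.isBlowup_subscheme_controlledTransform_of_isEffectiveCartier hHC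
    (hπ.isEffectiveCartier_comap_subschemeι_controlledTransform_of_isRegular hX hC hHC hH) πS hπS

/-- **`ker Bl_C(k) = (π^*(ker k) : 𝓘(D))` for a regular closed subscheme `k : W ↪ X` through the regular centre
`V(C)` of a blow-up of a regular `X`** (the ideal of the strict transform of `W` is the transform of `𝓘_W` with
exponent one; GW 13.91 (1) / 13.96 (2) with BGMW §4 Remark (3)).
[cite: BierstoneGrigorievMilmanWlodarczyk2011, §4 Remark (3)] [cite: GortzWedhorn2020, Prop. 13.91 (1), Prop. 13.96 (2)] -/
theorem IsBlowup.ker_strictTransformHom_of_isRegular {W W' : Scheme.{u}} {k : W ⟶ X} [IsClosedImmersion k]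
    {ρ : W' ⟶ W} (hX : Scheme.IsRegular X) (hπ : IsBlowup π C) (hC : Scheme.IsRegular C.subscheme)
    (hρ : IsBlowup ρ (C.comap k)) (hCk : k.ker ≤ C) (hW : Scheme.IsRegular k.ker.subscheme) :
    (hπ.strictTransformHom hρ).ker = controlledTransform π C k.ker 1 :=
  hπ.ker_strictTransformHom_of_isEffectiveCartier hρ hCk
    (hπ.isEffectiveCartier_comap_subschemeι_controlledTransform_of_isRegular hX hC hCk hW)

end Local

end Literature.AlgebraicGeometry.Resolution

end
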